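/-
Copyright (c) 2026 the pub-hodgecm-mathlib formalisation cell (harness21).  Prover seat hodgecm-mathlib-F0P3a-p04 (g12): PAYMENT of the line's type-(1) value stub
`stub_splitGValue1` («N7nsCount» ED. 1.5 :280) MODULO ONE INSTANCE — architect A-p06 (g26), LEAD F0P3a-plan (g9); inputs ★ p841906 (this seat), ★ p842055
(F0P3b-p01 (g6)'s X₁ at `L_w`, bridged by this seat), ★ p841570 (F0P3-p02 (g11)).
-/
import Literature.NumberTheory.Rogawski1990.UnitOrbitalIntegralValueOfCongr
import Literature.NumberTheory.Rogawski1990.UnitOrbitalIntegralInertValueThetaZeroAdicCompletion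
import Literature.NumberTheory.Rogawski1990.UnitFundamentalLemmaInertFlickerRepresentatives
import Literature.NumberTheory.Rogawski1990.UnitFundamentalLemmaInertFlickerFrame
import Literature.NumberTheory.Automorphic.UnitOrbitalIntegralFixedPoints
import Literature.NumberTheory.Automorphic.AdicCompletionIntegersAdicComplete                -- ★ p842102: `IsAdicComplete 𝓂[𝒪_w] 𝒪_w` (ED. 2)
import HarnessLib

/-!
# The type-(1) value stub `X₁ = φ₀(N₁,N₂,N)` of the line «N7nsCount» in its own frame, modulo the `𝔪`-adic completeness instance of `𝒪_w`
# (Flicker 1998 Prop. 14; Rogawski 1990 Prop. 4.9.1 (b))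

Topic `NumberTheory/Rogawski1990`; namespace `Literature.NumberTheory.Rogawski1990`.  THEOREMS ONLY (no definition, no instance, no notation, no named fact, no `sorry`);
kernel lane.  **`classOrbitalIntegral_indicator_eq_phiZero_of_congr`** = the statement of `stub_splitGValue1` (ED. 1.5 fragment 16dac136, binders VERBATIM) with ONE extra
instance binder `[IsAdicComplete 𝓂[𝒪_w] 𝒪_w]` (`𝒪_w` the `Valued` integers of `L_w`; mathematically automatic, carried as in the tree's Kato files until a Mathlib-side
instance for `Valued.integer (w.adicCompletion L)` is named).  PROOF = ★ `classOrbitalIntegral_indicator_eq_natCard_fixedPoints_of_congr` (the (F12)-side: the frame of `t`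
is `Tl⁻¹ P₁`, ★ `flickerTorusElt_one_mul_frame`) ∘ ★ `natCard_fixedPoints_unitaryInt_corner_eq_phiZero_adicCompletion` (F0P3b-p01's X₁ read at `w`: the literal through ★
`coe_coe_localNonsplitEquiv_apply`, `a w = α`, `d w = γ`, `σ_w` through ★ `conjLocal_apply_eq_of_smul_eq`, `|2|` through `w ∣ v`, finiteness through ★
`finite_fixedBy_cmLocalIntegralLevel_iff_of_congr` ∘ ★ `finite_fixedBy_quotient_of_isClosed`).  HONEST LABEL: HC_CM is proved only modulo the printed citations until
rung 0 closes; the line's stub stays OPEN until the instance is supplied (then `stub_splitGValue1 := classOrbitalIntegral_indicator_eq_phiZero_of_congr …`).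

## References
* [Flicker1998UnitaryFL] Y. Z. Flicker, *Elementary proof of the fundamental lemma for a unitary group*, Canad. J. Math. 50 (1998), Prop. 14 p. 94, §6 p. 95.
* [Rogawski1990] J. D. Rogawski, *Automorphic Representations of Unitary Groups in Three Variables* (1990), §4.9 Prop. 4.9.1 (b) p. 55, §14.2 p. 233.
-/

set_option autoImplicit false

noncomputable section

open MeasureTheory Measure Set Function NumberField IsDedekindDomain Matrix Polynomial
open Literature.NumberTheory.Automorphic Literature.NumberTheory.Automorphic.UnitaryGroup
open Literature.NumberTheory.Automorphic.IntegralReduction Literature.NumberTheory.GaloisRepresentations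
open scoped Matrix MatrixGroups ValuativeRel

namespace Literature.NumberTheory.Rogawski1990

section ValueOne

variable (L : Type) [Field L] [NumberField L] [IsCMField L] (H' : Matrix (Fin 3) (Fin 3) L)
  {v : HeightOneSpectrum (𝓞 ↥(maximalRealSubfield L))}

/-- Flicker's frame `P₁ = [[1,0,1],[0,1,0],[−1,0,1]]` times `[[e,0,−e],[0,1,0],[e,0,e]]` is `1` when `2e = 1` (generic ring; instantiated at `E_v`).
[cite: Flicker1998UnitaryFL, §1 p. 76] -/
private theorem flickerFrame_mul_half_eq_one {R : Type*} [CommRing R] {e : R} (h2e : 2 * e = 1) :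
    !![(1 : R), 0, 1; 0, 1, 0; -1, 0, 1] * !![e, 0, -e; 0, 1, 0; e, 0, e] = 1 := by
  ext i j
  fin_cases i <;> fin_cases j <;> simp [Matrix.mul_apply, Fin.sum_univ_three] <;> linear_combination h2e

/-- The same product in the other order. [cite: Flicker1998UnitaryFL, §1 p. 76] -/
private theorem half_mul_flickerFrame_eq_one {R : Type*} [CommRing R] {e : R} (h2e : 2 * e = 1) :
    !![e, 0, -e; 0, 1, 0; e, 0, e] * !![(1 : R), 0, 1; 0, 1, 0; -1, 0, 1] = 1 := by
  ext i j
  fin_cases i <;> fin_cases j <;> simp [Matrix.mul_apply, Fin.sum_univ_three] <;> linear_combination h2e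

set_option synthInstance.maxHeartbeats 200000 in  -- the coset action `U_w ↷ U_w ⧸ unitaryInt` (as in ★ `FixedCosetsTransport`)
set_option maxHeartbeats 400000 in
open scoped Classical in
/-- **`stub_splitGValue1` MODULO `[IsAdicComplete 𝓂[𝒪_w] 𝒪_w]`**: `Φ(⟦t⟧, 1_{K′}) = φ₀(N₁, N₂, N)` for any `t ∈ G′_v` carried by a level-preserving congruence to
Flicker's `t_1(a, u, d)`. [cite: Flicker1998UnitaryFL, Prop. 14 p. 94; §6 p. 95] [cite: Rogawski1990, §4.9 Prop. 4.9.1 (b) p. 55] -/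
theorem classOrbitalIntegral_indicator_eq_phiZero_of_congr
    (hH' : (H'.map (IsCMField.complexConj L))ᵀ = H') (w : PlacesOver L v)
    (hw : IsCMField.complexConj L • w.1 = w.1) (hv : Algebra.IsUnramifiedIn (𝓞 L) v.asIdeal)
    [IsAdicComplete (IsLocalRing.maximalIdeal (Valued.integer (w.1.adicCompletion L))) (Valued.integer (w.1.adicCompletion L))]
    (hH'w : IsUnit (placeForm H' w.1)) (_hH'i : hH'w.unit ∈ glInt 3 (w.1.adicCompletion L))
    (μ : HeckeCharacter L) (_hμ : μ.IsUnramifiedAt w.1)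
    [MeasurableSpace ((cmDatum L 3 H').Local v)] [BorelSpace ((cmDatum L 3 H').Local v)]
    [∀ γ : ((cmDatum L 3 H').Local v), MeasurableSpace (((cmDatum L 3 H').Local v) ⧸ Subgroup.centralizer ({γ} : Set ((cmDatum L 3 H').Local v)))]
    [∀ γ : ((cmDatum L 3 H').Local v), BorelSpace (((cmDatum L 3 H').Local v) ⧸ Subgroup.centralizer ({γ} : Set ((cmDatum L 3 H').Local v)))]
    [MeasurableSpace ((cmDatum L 2 (Matrix.of fun i j : Fin 2 => if i.val + j.val + 1 = 2 then (1 : L) else 0)).Local v ×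
      (cmDatum L 1 (Matrix.of fun i j : Fin 1 => if i.val + j.val + 1 = 1 then (1 : L) else 0)).Local v)]
    [BorelSpace ((cmDatum L 2 (Matrix.of fun i j : Fin 2 => if i.val + j.val + 1 = 2 then (1 : L) else 0)).Local v ×
      (cmDatum L 1 (Matrix.of fun i j : Fin 1 => if i.val + j.val + 1 = 1 then (1 : L) else 0)).Local v)]
    [∀ a : ((cmDatum L 2 (Matrix.of fun i j : Fin 2 => if i.val + j.val + 1 = 2 then (1 : L) else 0)).Local v ×
      (cmDatum L 1 (Matrix.of fun i j : Fin 1 => if i.val + j.val + 1 = 1 then (1 : L) else 0)).Local v),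
      MeasurableSpace (((cmDatum L 2 (Matrix.of fun i j : Fin 2 => if i.val + j.val + 1 = 2 then (1 : L) else 0)).Local v ×
      (cmDatum L 1 (Matrix.of fun i j : Fin 1 => if i.val + j.val + 1 = 1 then (1 : L) else 0)).Local v) ⧸ Subgroup.centralizer ({a} : Set ((cmDatum L 2 (Matrix.of fun i j : Fin 2 => if i.val + j.val + 1 = 2 then (1 : L) else 0)).Local v ×
      (cmDatum L 1 (Matrix.of fun i j : Fin 1 => if i.val + j.val + 1 = 1 then (1 : L) else 0)).Local v)))]
    [∀ a : ((cmDatum L 2 (Matrix.of fun i j : Fin 2 => if i.val + j.val + 1 = 2 then (1 : L) else 0)).Local v ×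
      (cmDatum L 1 (Matrix.of fun i j : Fin 1 => if i.val + j.val + 1 = 1 then (1 : L) else 0)).Local v),
      BorelSpace (((cmDatum L 2 (Matrix.of fun i j : Fin 2 => if i.val + j.val + 1 = 2 then (1 : L) else 0)).Local v ×
      (cmDatum L 1 (Matrix.of fun i j : Fin 1 => if i.val + j.val + 1 = 1 then (1 : L) else 0)).Local v) ⧸ Subgroup.centralizer ({a} : Set ((cmDatum L 2 (Matrix.of fun i j : Fin 2 => if i.val + j.val + 1 = 2 then (1 : L) else 0)).Local v ×
      (cmDatum L 1 (Matrix.of fun i j : Fin 1 => if i.val + j.val + 1 = 1 then (1 : L) else 0)).Local v)))]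
    (νH : Measure ((cmDatum L 2 (Matrix.of fun i j : Fin 2 => if i.val + j.val + 1 = 2 then (1 : L) else 0)).Local v ×
      (cmDatum L 1 (Matrix.of fun i j : Fin 1 => if i.val + j.val + 1 = 1 then (1 : L) else 0)).Local v)) [νH.IsHaarMeasure] [νH.IsMulRightInvariant]
    (νG : Measure ((cmDatum L 3 H').Local v)) [νG.IsHaarMeasure] [νG.IsMulRightInvariant]
    {mH : OrbitalMeasureFamily ((cmDatum L 2 (Matrix.of fun i j : Fin 2 => if i.val + j.val + 1 = 2 then (1 : L) else 0)).Local v ×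
      (cmDatum L 1 (Matrix.of fun i j : Fin 1 => if i.val + j.val + 1 = 1 then (1 : L) else 0)).Local v)} {mG : OrbitalMeasureFamily ((cmDatum L 3 H').Local v)}
    (_hmH : mH.IsCanonical (IsLocalGRegular L v) νH)
    (hmG : mG.IsCanonical (fun γ => IsRegularElt (γ.val : GL (Fin 3) (UnitaryGroup.LocalRing L v))) νG)
    (_hνH : νH ((((cmLocalIntegralLevel L 2 (Matrix.of fun i j : Fin 2 => if i.val + j.val + 1 = 2 then (1 : L) else 0) v).prod
      (cmLocalIntegralLevel L 1 (Matrix.of fun i j : Fin 1 => if i.val + j.val + 1 = 1 then (1 : L) else 0) v)) : Subgroup ((cmDatum L 2 (Matrix.of fun i j : Fin 2 => if i.val + j.val + 1 = 2 then (1 : L) else 0)).Local v ×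
      (cmDatum L 1 (Matrix.of fun i j : Fin 1 => if i.val + j.val + 1 = 1 then (1 : L) else 0)).Local v)) : Set ((cmDatum L 2 (Matrix.of fun i j : Fin 2 => if i.val + j.val + 1 = 2 then (1 : L) else 0)).Local v ×
      (cmDatum L 1 (Matrix.of fun i j : Fin 1 => if i.val + j.val + 1 = 1 then (1 : L) else 0)).Local v)) = 1)
    (hνG : νG (cmLocalIntegralLevel L 3 H' v : Set ((cmDatum L 3 H').Local v)) = 1)
    (_hl : ∀ (v : HeightOneSpectrum (𝓞 ↥(maximalRealSubfield L)))
      (a : (cmDatum L 2 (Matrix.of fun i j : Fin 2 => if i.val + j.val + 1 = 2 then (1 : L) else 0)).Local v ×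
      (cmDatum L 1 (Matrix.of fun i j : Fin 1 => if i.val + j.val + 1 = 1 then (1 : L) else 0)).Local v)
      (b : (cmDatum L 3 H').Local v)
      (x : (cmDatum L 2 (Matrix.of fun i j : Fin 2 => if i.val + j.val + 1 = 2 then (1 : L) else 0)).Local v ×
      (cmDatum L 1 (Matrix.of fun i j : Fin 1 => if i.val + j.val + 1 = 1 then (1 : L) else 0)).Local v),
      finExplicitDelta L v H' (x * a * x⁻¹) μ b = finExplicitDelta L v H' a μ b)
    (_hr : ∀ (v : HeightOneSpectrum (𝓞 ↥(maximalRealSubfield L)))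
      (a : (cmDatum L 2 (Matrix.of fun i j : Fin 2 => if i.val + j.val + 1 = 2 then (1 : L) else 0)).Local v ×
      (cmDatum L 1 (Matrix.of fun i j : Fin 1 => if i.val + j.val + 1 = 1 then (1 : L) else 0)).Local v)
      (b y : (cmDatum L 3 H').Local v),
      finExplicitDelta L v H' a μ (y * b * y⁻¹) = finExplicitDelta L v H' a μ b)
    (hH'u : IsUnit H') (_hμu : μ.IsUnitary)
    (_hμω : ∀ x : ideleGroup ↥(maximalRealSubfield L), μ (AdeleRing.ideleBaseChange ↥(maximalRealSubfield L) L x) = quadraticHeckeCharCM L x)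
    (h2 : IsUnit (2 : 𝒪[w.1.adicCompletion L]))
    {γH : ((cmDatum L 2 (Matrix.of fun i j : Fin 2 => if i.val + j.val + 1 = 2 then (1 : L) else 0)).Local v ×
      (cmDatum L 1 (Matrix.of fun i j : Fin 1 => if i.val + j.val + 1 = 1 then (1 : L) else 0)).Local v)}
    (_hreg : IsLocalGRegular L v γH)
    (_hint : ∀ i : ℕ, ((((endoEmbLocal L v γH).val : GL (Fin 3) (LocalRing L v)).val.map
        (Pi.evalRingHom (fun w' : PlacesOver L v => w'.1.adicCompletion L) w)).charpoly.coeff i) ∈ 𝒪[w.1.adicCompletion L])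
    (_hP1 : ¬ ∃ γH₀ : ((cmDatum L 2 (Matrix.of fun i j : Fin 2 => if i.val + j.val + 1 = 2 then (1 : L) else 0)).Local v ×
      (cmDatum L 1 (Matrix.of fun i j : Fin 1 => if i.val + j.val + 1 = 1 then (1 : L) else 0)).Local v),
        γH₀ ∈ ((cmLocalIntegralLevel L 2 (Matrix.of fun i j : Fin 2 => if i.val + j.val + 1 = 2 then (1 : L) else 0) v).prod
      (cmLocalIntegralLevel L 1 (Matrix.of fun i j : Fin 1 => if i.val + j.val + 1 = 1 then (1 : L) else 0) v)) ∧ IsLocalGRegular L v γH₀ ∧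
        (redMat (((endoEmbLocal L v γH₀).val : GL (Fin 3) (LocalRing L v)).val.map
          (Pi.evalRingHom (fun w' : PlacesOver L v => w'.1.adicCompletion L) w))).charpoly.Separable ∧
        IsLocalStablyConjH L v γH₀ γH)
    (_hell : ¬ ∃ (y : ((cmDatum L 2 (Matrix.of fun i j : Fin 2 => if i.val + j.val + 1 = 2 then (1 : L) else 0)).Local v ×
      (cmDatum L 1 (Matrix.of fun i j : Fin 1 => if i.val + j.val + 1 = 1 then (1 : L) else 0)).Local v)) (d' : Fin 2 → (UnitaryGroup.LocalRing L v)ˣ),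
        glDiagonal 2 (UnitaryGroup.LocalRing L v) d' = ((y * γH * y⁻¹).1.val : GL (Fin 2) (UnitaryGroup.LocalRing L v)))
    (_hsplit : ∃ x : w.1.adicCompletion L, (((γH.1.val : GL (Fin 2) (LocalRing L v)).val.map
        (Pi.evalRingHom (fun w' : PlacesOver L v => w'.1.adicCompletion L) w)).charpoly).IsRoot x)
    (α γ : w.1.adicCompletion L) (N₁ N₂ N : ℕ)
    (_hα : ((((γH.1.val : GL (Fin 2) (LocalRing L v)) : Matrix (Fin 2) (Fin 2) (LocalRing L v)).charpoly).map
        (Pi.evalRingHom (fun w' : PlacesOver L v => w'.1.adicCompletion L) w)).IsRoot α)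
    (_hγ : ((((γH.1.val : GL (Fin 2) (LocalRing L v)) : Matrix (Fin 2) (Fin 2) (LocalRing L v)).charpoly).map
        (Pi.evalRingHom (fun w' : PlacesOver L v => w'.1.adicCompletion L) w)).IsRoot γ)
    (_hαγ : α ≠ γ)
    (hN₁ : Valued.v (α - finGammaTwo L v γH w) = WithZero.exp (-(N₁ : ℤ)))
    (hN₂ : Valued.v (γ - finGammaTwo L v γH w) = WithZero.exp (-(N₂ : ℤ)))
    (hN : Valued.v (α - γ) = WithZero.exp (-(N : ℤ)))
    (htri : ((N₁ = N₂ ∧ N₁ ≤ N) ∨ (N₁ = N ∧ N₁ ≤ N₂) ∨ (N₂ = N ∧ N₂ ≤ N₁)))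
    -- Flicker's scalars over `E_v` (★ `exists_flicker_scalars_of_nonsplit`) and an eigenframe of `g` (★ (E1)), with the root links
    {e π π' x y a d : LocalRing L v} (h2e : 2 * e = 1) (_hσπ : conjLocal L (IsCMField.complexConj L) v π = π) (_hππ : π * π' = 1)
    (_hπN : ∀ z : LocalRing L v, conjLocal L (IsCMField.complexConj L) v z * z ≠ π)
    (_hx : conjLocal L (IsCMField.complexConj L) v x * x = 2) (hy : conjLocal L (IsCMField.complexConj L) v y * y = -2)
    (ha1 : conjLocal L (IsCMField.complexConj L) v a * a = 1) (hd1 : conjLocal L (IsCMField.complexConj L) v d * d = 1)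
    {P₂ : GL (Fin 2) (LocalRing L v)} (_hP₂ : (γH.1.val.val : Matrix (Fin 2) (Fin 2) (LocalRing L v)) * P₂.val = P₂.val * diagonal ![a, d])
    (had : a ≠ d) (hab : a ≠ finGammaTwo L v γH) (hbd : finGammaTwo L v γH ≠ d) (haw : a w = α) (hdw : d w = γ)
    -- the class: ANY `t ∈ G′_v` mapped to the literal by a LEVEL-PRESERVING congruence `ψ g = Tl g Tl⁻¹`
    (Tl : GL (Fin 3) (LocalRing L v))
    (ψ : ↥(UnitaryGroup.«local» L (IsCMField.complexConj L) 3 H' v) ≃ₜ*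
        ↥(UnitaryGroup.«local» L (IsCMField.complexConj L) 3 (Matrix.of fun i j : Fin 3 => if i.val + j.val + 1 = 3 then (1 : L) else 0) v))
    (t : (cmDatum L 3 H').Local v)
    (_hform : formCongr (conjLocal L (IsCMField.complexConj L) v) Tl (Matrix.of fun i j : Fin 3 => if i.val + j.val + 1 = 3 then (1 : LocalRing L v) else 0) =
          (adelicForm L 3 H').map (adeleToLocal L v))
    (hψ : ∀ g, (ψ g).val = Tl * g.val * Tl⁻¹)
    (hlev : ∀ g, g ∈ cmLocalIntegralLevel L 3 H' v ↔
        ψ g ∈ cmLocalIntegralLevel L 3 (Matrix.of fun i j : Fin 3 => if i.val + j.val + 1 = 3 then (1 : L) else 0) v)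
    (hlit : (ψ t).val.val =
          !![e * (a + d), 0, -(e * (a - d)); 0, finGammaTwo L v γH, 0; -(e * (a - d)), 0, e * (a + d)]) :
    classOrbitalIntegral mG ((cmLocalIntegralLevel L 3 H' v : Set ((cmDatum L 3 H').Local v)).indicator fun _ => (1 : ℂ)) (ConjClasses.mk t) =
      ((Flicker1998.phiZero (Ideal.absNorm v.asIdeal) N₁ N₂ N : ℚ) : ℂ) := by
  have hc1 : IsCMField.complexConj L ≠ 1 := IsCMField.complexConj_ne_one L
  haveI : Algebra.IsQuadraticExtension ↥(maximalRealSubfield L) L := IsCMField.isQuadraticExtension L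
  -- (1) the frame of `t`: `t (Tl⁻¹ P₁) = (Tl⁻¹ P₁) diag(a, u, d)`, `P₁` Flicker's frame with the explicit inverse `[[e,0,−e],[0,1,0],[e,0,e]]`
  have hPinv1 : !![(1 : LocalRing L v), 0, 1; 0, 1, 0; -1, 0, 1] * !![e, 0, -e; 0, 1, 0; e, 0, e] = 1 := flickerFrame_mul_half_eq_one h2e
  have hPinv2 : !![e, 0, -e; 0, 1, 0; e, 0, e] * !![(1 : LocalRing L v), 0, 1; 0, 1, 0; -1, 0, 1] = 1 := half_mul_flickerFrame_eq_one h2e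
  set P₁ : GL (Fin 3) (LocalRing L v) := ⟨_, _, hPinv1, hPinv2⟩ with hP₁def
  have hP₁ : P₁.val = !![(1 : LocalRing L v), 0, 1; 0, 1, 0; -1, 0, 1] := rfl
  have htval : (t.val.val : Matrix (Fin 3) (Fin 3) (LocalRing L v)) = Tl⁻¹.val * (ψ t).val.val * Tl.val := by
    rw [hψ t, Units.val_mul, Units.val_mul, ← Matrix.mul_assoc, ← Matrix.mul_assoc, ← Units.val_mul, inv_mul_cancel, Units.val_one, Matrix.one_mul,
      Matrix.mul_assoc, ← Units.val_mul, inv_mul_cancel, Units.val_one, Matrix.mul_one]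
  have hQ : (t.val.val : Matrix (Fin 3) (Fin 3) (LocalRing L v)) * (Tl⁻¹ * P₁).val = (Tl⁻¹ * P₁).val * diagonal ![a, finGammaTwo L v γH, d] := by
    rw [htval, Units.val_mul, hlit, hP₁, Matrix.mul_assoc, Matrix.mul_assoc, ← Matrix.mul_assoc Tl.val, ← Units.val_mul, mul_inv_cancel, Units.val_one,
      Matrix.one_mul, flickerTorusElt_one_mul_frame h2e, etaDiag_eq_diagonal, ← Matrix.mul_assoc]
  have hu : Function.Injective ![a, finGammaTwo L v γH, d] := by
    intro i j hij
    fin_cases i <;> fin_cases j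
    all_goals first | rfl | (exfalso; revert hij; simp [hab, hbd, had, hab.symm, hbd.symm, had.symm])
  have hb1 := conjLocal_finGammaTwo_mul_finGammaTwo L v γH
  have hu1 : ∀ i, conjLocal L (IsCMField.complexConj L) v (![a, finGammaTwo L v γH, d] i) * ![a, finGammaTwo L v γH, d] i = 1 := by
    intro i; fin_cases i
    · exact ha1
    · exact hb1
    · exact hd1
  -- (2) the (F12)-side: `Φ(⟦t⟧, 1_{K′}) = ↑#Fix(e(ψ t))`
  rw [classOrbitalIntegral_indicator_eq_natCard_fixedPoints_of_congr L H' hH' hH'u w hw νG hmG hνG ψ hlev t hQ hu hu1]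
  -- (3) the data at `w`
  have h2L : (2 : 𝓞 L) ∉ w.1.asIdeal := by
    have h2w : Valued.v (2 : w.1.adicCompletion L) = 1 := (isUnit_two_integer_iff_valued_eq_one L w.1).1 h2
    have e1 : (algebraMap L (w.1.adicCompletion L)) (algebraMap (𝓞 L) L 2) = 2 := by rw [map_ofNat, map_ofNat]
    rw [← e1] at h2w
    change Valued.v ((algebraMap (𝓞 L) L 2 : L) : w.1.adicCompletion L) = 1 at h2w
    rw [HeightOneSpectrum.valuedAdicCompletion_eq_valuation', HeightOneSpectrum.valuation_of_algebraMap] at h2w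
    exact HeightOneSpectrum.intValuation_eq_one_iff.1 h2w
  have h2F : (2 : 𝓞 ↥(maximalRealSubfield L)) ∉ v.asIdeal := by
    intro hmem
    apply h2L
    have h := congrArg HeightOneSpectrum.asIdeal w.2
    rw [← h] at hmem
    simp only [HeightOneSpectrum.under_asIdeal, Ideal.under_def, Ideal.mem_comap, map_ofNat] at hmem
    exact hmem
  have hσw : ∀ z : LocalRing L v, conjLocal L (IsCMField.complexConj L) v z w = galAdicCompletionMap (L := L) (IsCMField.complexConj L) hw (z w) :=
    fun z => conjLocal_apply_eq_of_smul_eq (IsCMField.complexConj L) hc1 v w hw z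
  have hyw : y w * galAdicCompletionMap (L := L) (IsCMField.complexConj L) hw (y w) = -2 := by
    rw [← hσw, mul_comm]; exact (congrFun hy w : _)
  have haw1 : galAdicCompletionMap (L := L) (IsCMField.complexConj L) hw α * α = 1 := by
    rw [← haw, ← hσw]; exact (congrFun ha1 w : _)
  have hbw1 : galAdicCompletionMap (L := L) (IsCMField.complexConj L) hw (finGammaTwo L v γH w) * finGammaTwo L v γH w = 1 := by
    rw [← hσw]; exact (congrFun hb1 w : _)
  have hdw1 : galAdicCompletionMap (L := L) (IsCMField.complexConj L) hw γ * γ = 1 := by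
    rw [← hdw, ← hσw]; exact (congrFun hd1 w : _)
  have h2ew : 2 * e w = 1 := by
    have := congrFun h2e w; simpa using this
  -- the literal read at `w`
  have hte : (((localNonsplitEquiv (IsCMField.complexConj L) (Matrix.of fun i j : Fin 3 => if i.val + j.val + 1 = 3 then (1 : L) else 0) hc1 w hw (ψ t) :
        unitaryGroupOfForm (galAdicCompletionMap (L := L) (IsCMField.complexConj L) hw)
          (placeForm (Matrix.of fun i j : Fin 3 => if i.val + j.val + 1 = 3 then (1 : L) else 0) w.1)) :
        GL (Fin 3) (w.1.adicCompletion L)) : Matrix (Fin 3) (Fin 3) (w.1.adicCompletion L)) =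
      !![e w * (α + γ), 0, -(e w * (α - γ)); 0, finGammaTwo L v γH w, 0; -(e w * (α - γ)), 0, e w * (α + γ)] := by
    rw [coe_coe_localNonsplitEquiv_apply, hlit, ← haw, ← hdw]
    ext i j
    fin_cases i <;> fin_cases j <;> rfl
  -- finiteness of the fixed cosets (elliptic regular `t`)
  have hH'c : (H'.map (cmConjRingHom L))ᵀ = H' := by
    have e1 : H'.map (cmConjRingHom L) = H'.map (IsCMField.complexConj L) := by
      ext i j; simp [Matrix.map_apply, cmConjRingHom_apply]
    rw [e1]; exact hH'
  have hdet : H'.det ≠ 0 := (Matrix.isUnit_iff_isUnit_det _ |>.1 hH'u).ne_zero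
  have hreg : IsRegularElt (t.val : GL (Fin 3) (LocalRing L v)) := isRegularElt_of_eigenframe L H' w hw t hQ hu
  haveI : CompactSpace (Subgroup.centralizer ({t} : Set ((cmDatum L 3 H').Local v))) :=
    compactSpace_centralizer_of_eigenframe_of_smul_eq L w hw H' hH'c hdet t hQ hu hu1
  have hfinG : (MulAction.fixedBy ((cmDatum L 3 H').Local v ⧸ cmLocalIntegralLevel L 3 H' v) t).Finite :=
    finite_fixedBy_quotient_of_isClosed t (cmLocalIntegralLevel L 3 H' v) (isClosed_conjClass_local_of_isRegularElt L 3 H' v hH'c hdet t hreg)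
      (isCompact_isOpen_cmLocalIntegralLevel L 3 H' v).2 (isCompact_isOpen_cmLocalIntegralLevel L 3 H' v).1
  have hfin := (finite_fixedBy_cmLocalIntegralLevel_iff_of_congr L H' w hw ψ hlev t).1 hfinG
  -- (4) F0P3b-p01's X₁ at `L_w`
  have hX := natCard_fixedPoints_unitaryInt_corner_eq_phiZero_adicCompletion L w hw hv h2F hyw h2ew haw1 hbw1 hdw1 hte hN hN₁ hN₂ htri hfin
  exact_mod_cast congrArg (fun r : ℚ => (r : ℂ)) hX


/-! ## ED. 2 (pen F0P3a-p04 (g12), 2026-09-01): the instance binder DISCHARGED by ★ p842102 `isAdicComplete_maximalIdeal_valuedInteger_adicCompletion` —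
`classOrbitalIntegral_indicator_eq_phiZero_of_congr'` is `stub_splitGValue1`'s statement VERBATIM (no extra binder), so the line's fold is the one-liner
`stub_splitGValue1 … := classOrbitalIntegral_indicator_eq_phiZero_of_congr' L H' …` (positional). -/

set_option synthInstance.maxHeartbeats 200000 in  -- as above
open scoped Classical in
/-- **`stub_splitGValue1` UNCONDITIONALLY** (the statement of the line's type-(1) value stub VERBATIM): `Φ(⟦t⟧, 1_{K′}) = φ₀(N₁, N₂, N)`; the `𝔪`-adic completeness of
`𝒪_w` is ★ `isAdicComplete_maximalIdeal_valuedInteger_adicCompletion`. [cite: Flicker1998UnitaryFL, Prop. 14 p. 94; §6 p. 95] [cite: Rogawski1990, §4.9 Prop. 4.9.1 (b) p. 55] -/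
theorem classOrbitalIntegral_indicator_eq_phiZero_of_congr'
    (hH' : (H'.map (IsCMField.complexConj L))ᵀ = H') (w : PlacesOver L v)
    (hw : IsCMField.complexConj L • w.1 = w.1) (hv : Algebra.IsUnramifiedIn (𝓞 L) v.asIdeal)
    (hH'w : IsUnit (placeForm H' w.1)) (_hH'i : hH'w.unit ∈ glInt 3 (w.1.adicCompletion L))
    (μ : HeckeCharacter L) (_hμ : μ.IsUnramifiedAt w.1)
    [MeasurableSpace ((cmDatum L 3 H').Local v)] [BorelSpace ((cmDatum L 3 H').Local v)]
    [∀ γ : ((cmDatum L 3 H').Local v), MeasurableSpace (((cmDatum L 3 H').Local v) ⧸ Subgroup.centralizer ({γ} : Set ((cmDatum L 3 H').Local v)))]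
    [∀ γ : ((cmDatum L 3 H').Local v), BorelSpace (((cmDatum L 3 H').Local v) ⧸ Subgroup.centralizer ({γ} : Set ((cmDatum L 3 H').Local v)))]
    [MeasurableSpace ((cmDatum L 2 (Matrix.of fun i j : Fin 2 => if i.val + j.val + 1 = 2 then (1 : L) else 0)).Local v ×
      (cmDatum L 1 (Matrix.of fun i j : Fin 1 => if i.val + j.val + 1 = 1 then (1 : L) else 0)).Local v)]
    [BorelSpace ((cmDatum L 2 (Matrix.of fun i j : Fin 2 => if i.val + j.val + 1 = 2 then (1 : L) else 0)).Local v ×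
      (cmDatum L 1 (Matrix.of fun i j : Fin 1 => if i.val + j.val + 1 = 1 then (1 : L) else 0)).Local v)]
    [∀ a : ((cmDatum L 2 (Matrix.of fun i j : Fin 2 => if i.val + j.val + 1 = 2 then (1 : L) else 0)).Local v ×
      (cmDatum L 1 (Matrix.of fun i j : Fin 1 => if i.val + j.val + 1 = 1 then (1 : L) else 0)).Local v),
      MeasurableSpace (((cmDatum L 2 (Matrix.of fun i j : Fin 2 => if i.val + j.val + 1 = 2 then (1 : L) else 0)).Local v ×
      (cmDatum L 1 (Matrix.of fun i j : Fin 1 => if i.val + j.val + 1 = 1 then (1 : L) else 0)).Local v) ⧸ Subgroup.centralizer ({a} : Set ((cmDatum L 2 (Matrix.of fun i j : Fin 2 => if i.val + j.val + 1 = 2 then (1 : L) else 0)).Local v ×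
      (cmDatum L 1 (Matrix.of fun i j : Fin 1 => if i.val + j.val + 1 = 1 then (1 : L) else 0)).Local v)))]
    [∀ a : ((cmDatum L 2 (Matrix.of fun i j : Fin 2 => if i.val + j.val + 1 = 2 then (1 : L) else 0)).Local v ×
      (cmDatum L 1 (Matrix.of fun i j : Fin 1 => if i.val + j.val + 1 = 1 then (1 : L) else 0)).Local v),
      BorelSpace (((cmDatum L 2 (Matrix.of fun i j : Fin 2 => if i.val + j.val + 1 = 2 then (1 : L) else 0)).Local v ×
      (cmDatum L 1 (Matrix.of fun i j : Fin 1 => if i.val + j.val + 1 = 1 then (1 : L) else 0)).Local v) ⧸ Subgroup.centralizer ({a} : Set ((cmDatum L 2 (Matrix.of fun i j : Fin 2 => if i.val + j.val + 1 = 2 then (1 : L) else 0)).Local v ×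
      (cmDatum L 1 (Matrix.of fun i j : Fin 1 => if i.val + j.val + 1 = 1 then (1 : L) else 0)).Local v)))]
    (νH : Measure ((cmDatum L 2 (Matrix.of fun i j : Fin 2 => if i.val + j.val + 1 = 2 then (1 : L) else 0)).Local v ×
      (cmDatum L 1 (Matrix.of fun i j : Fin 1 => if i.val + j.val + 1 = 1 then (1 : L) else 0)).Local v)) [νH.IsHaarMeasure] [νH.IsMulRightInvariant]
    (νG : Measure ((cmDatum L 3 H').Local v)) [νG.IsHaarMeasure] [νG.IsMulRightInvariant]
    {mH : OrbitalMeasureFamily ((cmDatum L 2 (Matrix.of fun i j : Fin 2 => if i.val + j.val + 1 = 2 then (1 : L) else 0)).Local v ×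
      (cmDatum L 1 (Matrix.of fun i j : Fin 1 => if i.val + j.val + 1 = 1 then (1 : L) else 0)).Local v)} {mG : OrbitalMeasureFamily ((cmDatum L 3 H').Local v)}
    (_hmH : mH.IsCanonical (IsLocalGRegular L v) νH)
    (hmG : mG.IsCanonical (fun γ => IsRegularElt (γ.val : GL (Fin 3) (UnitaryGroup.LocalRing L v))) νG)
    (_hνH : νH ((((cmLocalIntegralLevel L 2 (Matrix.of fun i j : Fin 2 => if i.val + j.val + 1 = 2 then (1 : L) else 0) v).prod
      (cmLocalIntegralLevel L 1 (Matrix.of fun i j : Fin 1 => if i.val + j.val + 1 = 1 then (1 : L) else 0) v)) : Subgroup ((cmDatum L 2 (Matrix.of fun i j : Fin 2 => if i.val + j.val + 1 = 2 then (1 : L) else 0)).Local v ×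
      (cmDatum L 1 (Matrix.of fun i j : Fin 1 => if i.val + j.val + 1 = 1 then (1 : L) else 0)).Local v)) : Set ((cmDatum L 2 (Matrix.of fun i j : Fin 2 => if i.val + j.val + 1 = 2 then (1 : L) else 0)).Local v ×
      (cmDatum L 1 (Matrix.of fun i j : Fin 1 => if i.val + j.val + 1 = 1 then (1 : L) else 0)).Local v)) = 1)
    (hνG : νG (cmLocalIntegralLevel L 3 H' v : Set ((cmDatum L 3 H').Local v)) = 1)
    (_hl : ∀ (v : HeightOneSpectrum (𝓞 ↥(maximalRealSubfield L)))
      (a : (cmDatum L 2 (Matrix.of fun i j : Fin 2 => if i.val + j.val + 1 = 2 then (1 : L) else 0)).Local v ×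
      (cmDatum L 1 (Matrix.of fun i j : Fin 1 => if i.val + j.val + 1 = 1 then (1 : L) else 0)).Local v)
      (b : (cmDatum L 3 H').Local v)
      (x : (cmDatum L 2 (Matrix.of fun i j : Fin 2 => if i.val + j.val + 1 = 2 then (1 : L) else 0)).Local v ×
      (cmDatum L 1 (Matrix.of fun i j : Fin 1 => if i.val + j.val + 1 = 1 then (1 : L) else 0)).Local v),
      finExplicitDelta L v H' (x * a * x⁻¹) μ b = finExplicitDelta L v H' a μ b)
    (_hr : ∀ (v : HeightOneSpectrum (𝓞 ↥(maximalRealSubfield L)))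
      (a : (cmDatum L 2 (Matrix.of fun i j : Fin 2 => if i.val + j.val + 1 = 2 then (1 : L) else 0)).Local v ×
      (cmDatum L 1 (Matrix.of fun i j : Fin 1 => if i.val + j.val + 1 = 1 then (1 : L) else 0)).Local v)
      (b y : (cmDatum L 3 H').Local v),
      finExplicitDelta L v H' a μ (y * b * y⁻¹) = finExplicitDelta L v H' a μ b)
    (hH'u : IsUnit H') (_hμu : μ.IsUnitary)
    (_hμω : ∀ x : ideleGroup ↥(maximalRealSubfield L), μ (AdeleRing.ideleBaseChange ↥(maximalRealSubfield L) L x) = quadraticHeckeCharCM L x)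
    (h2 : IsUnit (2 : 𝒪[w.1.adicCompletion L]))
    {γH : ((cmDatum L 2 (Matrix.of fun i j : Fin 2 => if i.val + j.val + 1 = 2 then (1 : L) else 0)).Local v ×
      (cmDatum L 1 (Matrix.of fun i j : Fin 1 => if i.val + j.val + 1 = 1 then (1 : L) else 0)).Local v)}
    (_hreg : IsLocalGRegular L v γH)
    (_hint : ∀ i : ℕ, ((((endoEmbLocal L v γH).val : GL (Fin 3) (LocalRing L v)).val.map
        (Pi.evalRingHom (fun w' : PlacesOver L v => w'.1.adicCompletion L) w)).charpoly.coeff i) ∈ 𝒪[w.1.adicCompletion L])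
    (_hP1 : ¬ ∃ γH₀ : ((cmDatum L 2 (Matrix.of fun i j : Fin 2 => if i.val + j.val + 1 = 2 then (1 : L) else 0)).Local v ×
      (cmDatum L 1 (Matrix.of fun i j : Fin 1 => if i.val + j.val + 1 = 1 then (1 : L) else 0)).Local v),
        γH₀ ∈ ((cmLocalIntegralLevel L 2 (Matrix.of fun i j : Fin 2 => if i.val + j.val + 1 = 2 then (1 : L) else 0) v).prod
      (cmLocalIntegralLevel L 1 (Matrix.of fun i j : Fin 1 => if i.val + j.val + 1 = 1 then (1 : L) else 0) v)) ∧ IsLocalGRegular L v γH₀ ∧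
        (redMat (((endoEmbLocal L v γH₀).val : GL (Fin 3) (LocalRing L v)).val.map
          (Pi.evalRingHom (fun w' : PlacesOver L v => w'.1.adicCompletion L) w))).charpoly.Separable ∧
        IsLocalStablyConjH L v γH₀ γH)
    (_hell : ¬ ∃ (y : ((cmDatum L 2 (Matrix.of fun i j : Fin 2 => if i.val + j.val + 1 = 2 then (1 : L) else 0)).Local v ×
      (cmDatum L 1 (Matrix.of fun i j : Fin 1 => if i.val + j.val + 1 = 1 then (1 : L) else 0)).Local v)) (d' : Fin 2 → (UnitaryGroup.LocalRing L v)ˣ),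
        glDiagonal 2 (UnitaryGroup.LocalRing L v) d' = ((y * γH * y⁻¹).1.val : GL (Fin 2) (UnitaryGroup.LocalRing L v)))
    (_hsplit : ∃ x : w.1.adicCompletion L, (((γH.1.val : GL (Fin 2) (LocalRing L v)).val.map
        (Pi.evalRingHom (fun w' : PlacesOver L v => w'.1.adicCompletion L) w)).charpoly).IsRoot x)
    (α γ : w.1.adicCompletion L) (N₁ N₂ N : ℕ)
    (_hα : ((((γH.1.val : GL (Fin 2) (LocalRing L v)) : Matrix (Fin 2) (Fin 2) (LocalRing L v)).charpoly).map
        (Pi.evalRingHom (fun w' : PlacesOver L v => w'.1.adicCompletion L) w)).IsRoot α)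
    (_hγ : ((((γH.1.val : GL (Fin 2) (LocalRing L v)) : Matrix (Fin 2) (Fin 2) (LocalRing L v)).charpoly).map
        (Pi.evalRingHom (fun w' : PlacesOver L v => w'.1.adicCompletion L) w)).IsRoot γ)
    (_hαγ : α ≠ γ)
    (hN₁ : Valued.v (α - finGammaTwo L v γH w) = WithZero.exp (-(N₁ : ℤ)))
    (hN₂ : Valued.v (γ - finGammaTwo L v γH w) = WithZero.exp (-(N₂ : ℤ)))
    (hN : Valued.v (α - γ) = WithZero.exp (-(N : ℤ)))
    (htri : ((N₁ = N₂ ∧ N₁ ≤ N) ∨ (N₁ = N ∧ N₁ ≤ N₂) ∨ (N₂ = N ∧ N₂ ≤ N₁)))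
    -- Flicker's scalars over `E_v` (★ `exists_flicker_scalars_of_nonsplit`) and an eigenframe of `g` (★ (E1)), with the root links
    {e π π' x y a d : LocalRing L v} (h2e : 2 * e = 1) (_hσπ : conjLocal L (IsCMField.complexConj L) v π = π) (_hππ : π * π' = 1)
    (_hπN : ∀ z : LocalRing L v, conjLocal L (IsCMField.complexConj L) v z * z ≠ π)
    (_hx : conjLocal L (IsCMField.complexConj L) v x * x = 2) (hy : conjLocal L (IsCMField.complexConj L) v y * y = -2)
    (ha1 : conjLocal L (IsCMField.complexConj L) v a * a = 1) (hd1 : conjLocal L (IsCMField.complexConj L) v d * d = 1)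
    {P₂ : GL (Fin 2) (LocalRing L v)} (_hP₂ : (γH.1.val.val : Matrix (Fin 2) (Fin 2) (LocalRing L v)) * P₂.val = P₂.val * diagonal ![a, d])
    (had : a ≠ d) (hab : a ≠ finGammaTwo L v γH) (hbd : finGammaTwo L v γH ≠ d) (haw : a w = α) (hdw : d w = γ)
    -- the class: ANY `t ∈ G′_v` mapped to the literal by a LEVEL-PRESERVING congruence `ψ g = Tl g Tl⁻¹`
    (Tl : GL (Fin 3) (LocalRing L v))
    (ψ : ↥(UnitaryGroup.«local» L (IsCMField.complexConj L) 3 H' v) ≃ₜ*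
        ↥(UnitaryGroup.«local» L (IsCMField.complexConj L) 3 (Matrix.of fun i j : Fin 3 => if i.val + j.val + 1 = 3 then (1 : L) else 0) v))
    (t : (cmDatum L 3 H').Local v)
    (_hform : formCongr (conjLocal L (IsCMField.complexConj L) v) Tl (Matrix.of fun i j : Fin 3 => if i.val + j.val + 1 = 3 then (1 : LocalRing L v) else 0) =
          (adelicForm L 3 H').map (adeleToLocal L v))
    (hψ : ∀ g, (ψ g).val = Tl * g.val * Tl⁻¹)
    (hlev : ∀ g, g ∈ cmLocalIntegralLevel L 3 H' v ↔
        ψ g ∈ cmLocalIntegralLevel L 3 (Matrix.of fun i j : Fin 3 => if i.val + j.val + 1 = 3 then (1 : L) else 0) v)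
    (hlit : (ψ t).val.val =
          !![e * (a + d), 0, -(e * (a - d)); 0, finGammaTwo L v γH, 0; -(e * (a - d)), 0, e * (a + d)]) :
    classOrbitalIntegral mG ((cmLocalIntegralLevel L 3 H' v : Set ((cmDatum L 3 H').Local v)).indicator fun _ => (1 : ℂ)) (ConjClasses.mk t) =
      ((Flicker1998.phiZero (Ideal.absNorm v.asIdeal) N₁ N₂ N : ℚ) : ℂ) := by
  haveI : IsAdicComplete (IsLocalRing.maximalIdeal (Valued.integer (w.1.adicCompletion L))) (Valued.integer (w.1.adicCompletion L)) :=
    isAdicComplete_maximalIdeal_valuedInteger_adicCompletion L w.1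
  exact classOrbitalIntegral_indicator_eq_phiZero_of_congr L H' hH' w hw hv hH'w _hH'i μ _hμ νH νG _hmH hmG _hνH hνG _hl _hr hH'u _hμu _hμω h2 _hreg _hint _hP1 _hell _hsplit α γ N₁ N₂ N _hα _hγ _hαγ hN₁ hN₂ hN htri h2e _hσπ _hππ _hπN _hx hy ha1 hd1 _hP₂ had hab hbd haw hdw Tl ψ t _hform hψ hlev hlit

end ValueOne

end Literature.NumberTheory.Rogawski1990

end
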